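import Mathlib
import Summits.Ventures.PercRepro2.CoinChainXAClosedGateGenSums
import Summits.Ventures.PercRepro2.CoinChainXATopGateInterp

/-!
# The TOP gate of the (j, j′) pair with ANY coin-entered set — the chain-data bridge
(blind cell PercRepro2, night-2 g30; §72.10)

For `ent = {m}`, any `ent' ∋ j, j'`, the entry markers `x = 1[j ∈ ·]`, `y = 1[j' ∈ ·]` and the TOP gate
`d' = d·1[{m, j, j'} ⊆ W]`, the cleared (XA′) `Cross ≤ a0·U001` holds whenever its ZERO-IDEAL-MASS value
(the parts functional at `a = 0` with the killed mass `a + δ`) is nonnegative — `chain_XA'_top_of_a0`: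
the four regions (ideal, coin-entered clusters missing `m`, the top cell `{m, j, j'} ⊆ W`, the rest of
the `m`-clusters), the moments of the gate laws, the Holley facts of the parts model and the two
KILLED-VS-GATE facts (`cg_fact_IMk`), and `cg_top_of_a0`.
-/

namespace Summit.Ventures.PercRepro2.Coin

open Classical

section TopGateBridge

variable {V : Type*} [DecidableEq V] {R : Type*} [Field R]
variable (U : Finset V) (m j j' : V) (ent' : Finset V) (ν c d : Finset V → R)

/-- The `m`-clusters split into the top cell and the rest. -/
theorem sum_M_split_top (f : Finset V → R) :
    ∑ W ∈ U.powerset.filter (fun W => ∃ r ∈ ({m} : Finset V), r ∈ W), f W =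
      (∑ W ∈ U.powerset.filter (fun W => m ∈ W ∧ j ∈ W ∧ j' ∈ W), f W) + (∑ W ∈ U.powerset.filter (fun W => m ∈ W ∧ ¬ (j ∈ W ∧ j' ∈ W)), f W) := by
  simp only [Finset.sum_filter]
  rw [← Finset.sum_add_distrib]
  refine Finset.sum_congr rfl (fun W _ => ?_)
  by_cases hm : m ∈ W
  · have hM : ∃ r ∈ ({m} : Finset V), r ∈ W := ⟨m, Finset.mem_singleton_self m, hm⟩
    by_cases hjj : j ∈ W ∧ j' ∈ W
    · rw [if_pos hM, if_pos ⟨hm, hjj.1, hjj.2⟩, if_neg (fun h => h.2 hjj)]; ring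
    · rw [if_pos hM, if_neg (fun h => hjj ⟨h.2.1, h.2.2⟩), if_pos ⟨hm, hjj⟩]; ring
  · have hM : ¬ ∃ r ∈ ({m} : Finset V), r ∈ W := fun ⟨r, hr, hrW⟩ => hm (Finset.mem_singleton.1 hr ▸ hrW)
    rw [if_neg hM, if_neg (fun h => hm h.1), if_neg (fun h => hm h.1)]; ring

/-- A filtered sum of the top gate over a cell inside the top is the `d`-sum. -/
lemma cg_top_sum_top (z : Finset V → R) :
    (∑ W ∈ U.powerset.filter (fun W => m ∈ W ∧ j ∈ W ∧ j' ∈ W), ν W * (if m ∈ W ∧ j ∈ W ∧ j' ∈ W then d W else 0) * z W) = (∑ W ∈ U.powerset.filter (fun W => m ∈ W ∧ j ∈ W ∧ j' ∈ W), ν W * d W * z W) :=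
  Finset.sum_congr rfl (fun W hW => by rw [if_pos (Finset.mem_filter.1 hW).2])

/-- A filtered sum of the top gate over a cell outside the top vanishes. -/
lemma cg_top_sum_rest (z : Finset V → R) :
    (∑ W ∈ U.powerset.filter (fun W => m ∈ W ∧ ¬ (j ∈ W ∧ j' ∈ W)), ν W * (if m ∈ W ∧ j ∈ W ∧ j' ∈ W then d W else 0) * z W) = 0 :=
  Finset.sum_eq_zero (fun W hW => by
    rw [if_neg (fun h => (Finset.mem_filter.1 hW).2.2 ⟨h.2.1, h.2.2⟩), mul_zero, zero_mul])

/-- The weighted closed-world gate moment of the top gate: `Σ_I νcz + Σ_D νcz + Σ_TOP νdz`. -/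
theorem cg_top_e (z : Finset V → R) :
    ∑ W ∈ U.powerset, ν W * chainMix {m} ent' 0 c (fun W => if m ∈ W ∧ j ∈ W ∧ j' ∈ W then d W else 0) W * z W =
      (∑ W ∈ U.powerset.filter (fun W => ¬ ∃ r ∈ ({m} : Finset V) ∪ ent', r ∈ W), ν W * c W * z W) + (∑ W ∈ U.powerset.filter (fun W => (¬ ∃ r ∈ ({m} : Finset V), r ∈ W) ∧ ∃ r ∈ ent', r ∈ W), ν W * c W * z W) + (∑ W ∈ U.powerset.filter (fun W => m ∈ W ∧ j ∈ W ∧ j' ∈ W), ν W * d W * z W) := by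
  rw [sum_three_regions U {m} ent', sum_M_split_top U m j j' (fun W => ν W * chainMix {m} ent' 0 c (fun W => if m ∈ W ∧ j ∈ W ∧ j' ∈ W then d W else 0) W * z W)]
  have hT : (∑ W ∈ U.powerset.filter (fun W => m ∈ W ∧ j ∈ W ∧ j' ∈ W), ν W * chainMix {m} ent' 0 c (fun W => if m ∈ W ∧ j ∈ W ∧ j' ∈ W then d W else 0) W * z W) = (∑ W ∈ U.powerset.filter (fun W => m ∈ W ∧ j ∈ W ∧ j' ∈ W), ν W * d W * z W) :=
    Finset.sum_congr rfl (fun W hW => by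
      have h := (Finset.mem_filter.1 hW).2
      rw [cgate_mix0_d {m} ent' c _ ⟨m, Finset.mem_singleton_self m, h.1⟩, if_pos h])
  have hR : (∑ W ∈ U.powerset.filter (fun W => m ∈ W ∧ ¬ (j ∈ W ∧ j' ∈ W)), ν W * chainMix {m} ent' 0 c (fun W => if m ∈ W ∧ j ∈ W ∧ j' ∈ W then d W else 0) W * z W) = 0 :=
    Finset.sum_eq_zero (fun W hW => by
      have h := (Finset.mem_filter.1 hW).2
      rw [cgate_mix0_d {m} ent' c _ ⟨m, Finset.mem_singleton_self m, h.1⟩, if_neg (fun h' => h.2 ⟨h'.2.1, h'.2.2⟩), mul_zero, zero_mul])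
  rw [hT, hR, add_zero]
  congr 1
  congr 1
  · exact Finset.sum_congr rfl (fun W hW => by
      rw [cgate_mix0_c {m} ent' c _ (cgate_not_meet_ent (Finset.mem_filter.1 hW).2)])
  · exact Finset.sum_congr rfl (fun W hW => by rw [cgate_mix0_c {m} ent' c _ (Finset.mem_filter.1 hW).2.1])

/-- The closed-world gate mass of the top gate. -/
theorem cg_top_e0 :
    ∑ W ∈ U.powerset, ν W * chainMix {m} ent' 0 c (fun W => if m ∈ W ∧ j ∈ W ∧ j' ∈ W then d W else 0) W =
      (∑ W ∈ U.powerset.filter (fun W => ¬ ∃ r ∈ ({m} : Finset V) ∪ ent', r ∈ W), ν W * c W) + (∑ W ∈ U.powerset.filter (fun W => (¬ ∃ r ∈ ({m} : Finset V), r ∈ W) ∧ ∃ r ∈ ent', r ∈ W), ν W * c W) + (∑ W ∈ U.powerset.filter (fun W => m ∈ W ∧ j ∈ W ∧ j' ∈ W), ν W * d W) := by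
  rw [sum_three_regions U {m} ent', sum_M_split_top U m j j' (fun W => ν W * chainMix {m} ent' 0 c (fun W => if m ∈ W ∧ j ∈ W ∧ j' ∈ W then d W else 0) W)]
  have hT : (∑ W ∈ U.powerset.filter (fun W => m ∈ W ∧ j ∈ W ∧ j' ∈ W), ν W * chainMix {m} ent' 0 c (fun W => if m ∈ W ∧ j ∈ W ∧ j' ∈ W then d W else 0) W) = (∑ W ∈ U.powerset.filter (fun W => m ∈ W ∧ j ∈ W ∧ j' ∈ W), ν W * d W) :=
    Finset.sum_congr rfl (fun W hW => by
      have h := (Finset.mem_filter.1 hW).2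
      rw [cgate_mix0_d {m} ent' c _ ⟨m, Finset.mem_singleton_self m, h.1⟩, if_pos h])
  have hR : (∑ W ∈ U.powerset.filter (fun W => m ∈ W ∧ ¬ (j ∈ W ∧ j' ∈ W)), ν W * chainMix {m} ent' 0 c (fun W => if m ∈ W ∧ j ∈ W ∧ j' ∈ W then d W else 0) W) = 0 :=
    Finset.sum_eq_zero (fun W hW => by
      have h := (Finset.mem_filter.1 hW).2
      rw [cgate_mix0_d {m} ent' c _ ⟨m, Finset.mem_singleton_self m, h.1⟩, if_neg (fun h' => h.2 ⟨h'.2.1, h'.2.2⟩), mul_zero])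
  rw [hT, hR, add_zero]
  congr 1
  congr 1
  · exact Finset.sum_congr rfl (fun W hW => by
      rw [cgate_mix0_c {m} ent' c _ (cgate_not_meet_ent (Finset.mem_filter.1 hW).2)])
  · exact Finset.sum_congr rfl (fun W hW => by rw [cgate_mix0_c {m} ent' c _ (Finset.mem_filter.1 hW).2.1])

/-- The weighted open-world gate moment of the top gate: `Σ_I νcz + Σ_TOP νdz`. -/
theorem cg_top_g (z : Finset V → R) :
    ∑ W ∈ U.powerset, ν W * chainMix {m} ent' 1 c (fun W => if m ∈ W ∧ j ∈ W ∧ j' ∈ W then d W else 0) W * z W =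
      (∑ W ∈ U.powerset.filter (fun W => ¬ ∃ r ∈ ({m} : Finset V) ∪ ent', r ∈ W), ν W * c W * z W) + (∑ W ∈ U.powerset.filter (fun W => m ∈ W ∧ j ∈ W ∧ j' ∈ W), ν W * d W * z W) := by
  rw [sum_three_regions U {m} ent', sum_M_split_top U m j j' (fun W => ν W * chainMix {m} ent' 1 c (fun W => if m ∈ W ∧ j ∈ W ∧ j' ∈ W then d W else 0) W * z W)]
  have hD : (∑ W ∈ U.powerset.filter (fun W => (¬ ∃ r ∈ ({m} : Finset V), r ∈ W) ∧ ∃ r ∈ ent', r ∈ W), ν W * chainMix {m} ent' 1 c (fun W => if m ∈ W ∧ j ∈ W ∧ j' ∈ W then d W else 0) W * z W) = 0 :=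
    Finset.sum_eq_zero (fun W hW => by
      have h := (Finset.mem_filter.1 hW).2
      rw [cgate_mix1_d {m} ent' c _ (cgate_meet_of_ent' h.2), if_neg (fun h' => h.1 ⟨m, Finset.mem_singleton_self m, h'.1⟩), mul_zero, zero_mul])
  have hT : (∑ W ∈ U.powerset.filter (fun W => m ∈ W ∧ j ∈ W ∧ j' ∈ W), ν W * chainMix {m} ent' 1 c (fun W => if m ∈ W ∧ j ∈ W ∧ j' ∈ W then d W else 0) W * z W) = (∑ W ∈ U.powerset.filter (fun W => m ∈ W ∧ j ∈ W ∧ j' ∈ W), ν W * d W * z W) :=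
    Finset.sum_congr rfl (fun W hW => by
      have h := (Finset.mem_filter.1 hW).2
      rw [cgate_mix1_d {m} ent' c _ (cgate_meet_of_ent ⟨m, Finset.mem_singleton_self m, h.1⟩), if_pos h])
  have hR : (∑ W ∈ U.powerset.filter (fun W => m ∈ W ∧ ¬ (j ∈ W ∧ j' ∈ W)), ν W * chainMix {m} ent' 1 c (fun W => if m ∈ W ∧ j ∈ W ∧ j' ∈ W then d W else 0) W * z W) = 0 :=
    Finset.sum_eq_zero (fun W hW => by
      have h := (Finset.mem_filter.1 hW).2
      rw [cgate_mix1_d {m} ent' c _ (cgate_meet_of_ent ⟨m, Finset.mem_singleton_self m, h.1⟩), if_neg (fun h' => h.2 ⟨h'.2.1, h'.2.2⟩), mul_zero, zero_mul])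
  rw [hD, hT, hR, add_zero, add_zero]
  congr 1
  exact Finset.sum_congr rfl (fun W hW => by rw [cgate_mix1_c {m} ent' c _ (Finset.mem_filter.1 hW).2])

/-- The open-world gate mass of the top gate: `Σ_I νc + Σ_TOP νd`. -/
theorem cg_top_g0 :
    ∑ W ∈ U.powerset, ν W * chainMix {m} ent' 1 c (fun W => if m ∈ W ∧ j ∈ W ∧ j' ∈ W then d W else 0) W =
      (∑ W ∈ U.powerset.filter (fun W => ¬ ∃ r ∈ ({m} : Finset V) ∪ ent', r ∈ W), ν W * c W) + (∑ W ∈ U.powerset.filter (fun W => m ∈ W ∧ j ∈ W ∧ j' ∈ W), ν W * d W) := by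
  rw [sum_three_regions U {m} ent', sum_M_split_top U m j j' (fun W => ν W * chainMix {m} ent' 1 c (fun W => if m ∈ W ∧ j ∈ W ∧ j' ∈ W then d W else 0) W)]
  have hD : (∑ W ∈ U.powerset.filter (fun W => (¬ ∃ r ∈ ({m} : Finset V), r ∈ W) ∧ ∃ r ∈ ent', r ∈ W), ν W * chainMix {m} ent' 1 c (fun W => if m ∈ W ∧ j ∈ W ∧ j' ∈ W then d W else 0) W) = 0 :=
    Finset.sum_eq_zero (fun W hW => by
      have h := (Finset.mem_filter.1 hW).2
      rw [cgate_mix1_d {m} ent' c _ (cgate_meet_of_ent' h.2), if_neg (fun h' => h.1 ⟨m, Finset.mem_singleton_self m, h'.1⟩), mul_zero])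
  have hT : (∑ W ∈ U.powerset.filter (fun W => m ∈ W ∧ j ∈ W ∧ j' ∈ W), ν W * chainMix {m} ent' 1 c (fun W => if m ∈ W ∧ j ∈ W ∧ j' ∈ W then d W else 0) W) = (∑ W ∈ U.powerset.filter (fun W => m ∈ W ∧ j ∈ W ∧ j' ∈ W), ν W * d W) :=
    Finset.sum_congr rfl (fun W hW => by
      have h := (Finset.mem_filter.1 hW).2
      rw [cgate_mix1_d {m} ent' c _ (cgate_meet_of_ent ⟨m, Finset.mem_singleton_self m, h.1⟩), if_pos h])
  have hR : (∑ W ∈ U.powerset.filter (fun W => m ∈ W ∧ ¬ (j ∈ W ∧ j' ∈ W)), ν W * chainMix {m} ent' 1 c (fun W => if m ∈ W ∧ j ∈ W ∧ j' ∈ W then d W else 0) W) = 0 :=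
    Finset.sum_eq_zero (fun W hW => by
      have h := (Finset.mem_filter.1 hW).2
      rw [cgate_mix1_d {m} ent' c _ (cgate_meet_of_ent ⟨m, Finset.mem_singleton_self m, h.1⟩), if_neg (fun h' => h.2 ⟨h'.2.1, h'.2.2⟩), mul_zero])
  rw [hD, hT, hR, add_zero, add_zero]
  congr 1
  exact Finset.sum_congr rfl (fun W hW => by rw [cgate_mix1_c {m} ent' c _ (Finset.mem_filter.1 hW).2])

omit [DecidableEq V] in
/-- A weighted sum over a cell where the weight is `1` equals the mass. -/
theorem cg_sum_weight_one (P : Finset V → Prop) [DecidablePred P] (f z : Finset V → R)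
    (h : ∀ W, P W → z W = 1) :
    ∑ W ∈ U.powerset.filter P, f W * z W = ∑ W ∈ U.powerset.filter P, f W :=
  Finset.sum_congr rfl (fun W hW => by rw [h W (Finset.mem_filter.1 hW).2, mul_one])

end TopGateBridge


section TopGateFacts

variable {V : Type*} [DecidableEq V] {R : Type*} [Field R] [LinearOrder R] [IsStrictOrderedRing R]
variable (U : Finset V) (m j j' : V) (ent' : Finset V) (ν c d : Finset V → R)
variable (hν0 : ∀ W, 0 ≤ ν W) (hν : ∀ s ⊆ U, ∀ t ⊆ U, ν s * ν t ≤ ν (s ∩ t) * ν (s ∪ t))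
  (hc0 : ∀ W, 0 ≤ c W) (hd0 : ∀ W, 0 ≤ d W) (hdc : ∀ W, d W ≤ c W)
  (hcd : ∀ s t, c s * d t ≤ c (s ∩ t) * d (s ∪ t))
  (hratio : ∀ s t, s ⊆ t → d s * c t ≤ c s * d t)

omit [LinearOrder R] [IsStrictOrderedRing R] in
/-- A marker-weighted filtered sum is the sum over the marked part of the cell. -/
theorem cg_sum_marker (P : Finset V → Prop) [DecidablePred P] (f x : Finset V → R) (v : V)
    (hx : ∀ W, x W = if v ∈ W then 1 else 0) :
    ∑ W ∈ U.powerset.filter P, f W * x W = ∑ W ∈ U.powerset.filter (fun W => P W ∧ v ∈ W), f W := by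
  have h1 : ∑ W ∈ (U.powerset.filter P).filter (fun W => v ∈ W), f W =
      ∑ W ∈ U.powerset.filter P, if v ∈ W then f W else 0 := Finset.sum_filter _ _
  rw [← Finset.filter_filter, h1]
  refine Finset.sum_congr rfl (fun W _ => ?_)
  rw [hx W]
  split_ifs <;> simp

include hν0 hν hc0 hd0 hdc hcd hratio in
/-- **The killed `x`-marked clusters against the gate-killed `y`-marked ones** (`IMk_x`): the meet is an
`ent`-free `x`-unmarked cluster, the join lies in the top cell. -/
theorem cg_fact_IMk (x : Finset V → R) (hx : ∀ W, x W = if j ∈ W then 1 else 0) :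
    (∑ W ∈ U.powerset.filter (fun W => ((¬ ∃ r ∈ ({m} : Finset V), r ∈ W) ∧ ∃ r ∈ ent', r ∈ W) ∧ j ∈ W), ν W * (c W - d W)) * (∑ W ∈ U.powerset.filter (fun W => (m ∈ W ∧ ¬ (j ∈ W ∧ j' ∈ W)) ∧ j' ∈ W), ν W * d W) ≤
      (∑ W ∈ U.powerset.filter (fun W => ¬ ∃ r ∈ ({m} : Finset V), r ∈ W), ν W * (if ∃ r ∈ ent', r ∈ W then c W - d W else c W) * (1 - x W)) * (∑ W ∈ U.powerset.filter (fun W => m ∈ W ∧ j ∈ W ∧ j' ∈ W), ν W * d W) := by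
  have hpw0 : ∀ W, 0 ≤ (if ∃ r ∈ ent', r ∈ W then c W - d W else c W) := fun W => by split_ifs <;> linarith [hdc W, hc0 W]
  have hx1 : ∀ W, 0 ≤ 1 - x W := fun W => by rw [hx W]; split_ifs <;> norm_num
  refine ad_sets_dec U (fun W => ν W * (c W - d W)) (fun W => ν W * d W)
    (fun W => ν W * (if ∃ r ∈ ent', r ∈ W then c W - d W else c W) * (1 - x W)) (fun W => ν W * d W)
    (fun W => mul_nonneg (hν0 W) (by linarith [hdc W])) (fun W => mul_nonneg (hν0 W) (hd0 W))
    (fun W => mul_nonneg (mul_nonneg (hν0 W) (hpw0 W)) (hx1 W)) (fun W => mul_nonneg (hν0 W) (hd0 W))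
    (fun W => ((¬ ∃ r ∈ ({m} : Finset V), r ∈ W) ∧ ∃ r ∈ ent', r ∈ W) ∧ j ∈ W) (fun W => (m ∈ W ∧ ¬ (j ∈ W ∧ j' ∈ W)) ∧ j' ∈ W) (fun W => ¬ ∃ r ∈ ({m} : Finset V), r ∈ W) (fun W => m ∈ W ∧ j ∈ W ∧ j' ∈ W) ?_
  intro s hs t ht hA hB
  have hjt : j ∉ t := fun h => hB.1.2 ⟨h, hB.2⟩
  have hms : m ∉ s := fun h => hA.1.1 ⟨m, Finset.mem_singleton_self m, h⟩
  refine ⟨fun ⟨r, hr, hrW⟩ => hms (Finset.mem_singleton.1 hr ▸ (Finset.mem_inter.1 hrW).1),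
    ⟨Finset.mem_union.2 (Or.inr hB.1.1), Finset.mem_union.2 (Or.inl hA.2), Finset.mem_union.2 (Or.inr hB.2)⟩, ?_⟩
  have hxst : x (s ∩ t) = 0 := by rw [hx]; exact if_neg (fun h => hjt (Finset.mem_inter.1 h).2)
  have hpiece : c (s ∩ t) - d (s ∩ t) ≤ (if ∃ r ∈ ent', r ∈ (s ∩ t) then c (s ∩ t) - d (s ∩ t) else c (s ∩ t)) := by
    split_ifs <;> linarith [hd0 (s ∩ t)]
  have hpw := closed_gate_pw c d hc0 hd0 hdc hcd hratio s t
  calc ν s * (c s - d s) * (ν t * d t) = (ν s * ν t) * ((c s - d s) * d t) := by ring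
    _ ≤ (ν (s ∩ t) * ν (s ∪ t)) * ((c (s ∩ t) - d (s ∩ t)) * d (s ∪ t)) :=
        mul_le_mul (hν s hs t ht) hpw (mul_nonneg (by linarith [hdc s]) (hd0 t)) (mul_nonneg (hν0 _) (hν0 _))
    _ ≤ (ν (s ∩ t) * ν (s ∪ t)) * ((if ∃ r ∈ ent', r ∈ (s ∩ t) then c (s ∩ t) - d (s ∩ t) else c (s ∩ t)) * d (s ∪ t)) :=
        mul_le_mul_of_nonneg_left (mul_le_mul_of_nonneg_right hpiece (hd0 _)) (mul_nonneg (hν0 _) (hν0 _))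
    _ = ν (s ∩ t) * (if ∃ r ∈ ent', r ∈ (s ∩ t) then c (s ∩ t) - d (s ∩ t) else c (s ∩ t)) * (1 - x (s ∩ t)) * (ν (s ∪ t) * d (s ∪ t)) := by
        rw [hxst]; ring

include hν0 hν hc0 hd0 hdc hcd hratio in
/-- The mirror of `cg_fact_IMk` (`IMk_y`). -/
theorem cg_fact_IMk' (y : Finset V → R) (hy : ∀ W, y W = if j' ∈ W then 1 else 0) :
    (∑ W ∈ U.powerset.filter (fun W => ((¬ ∃ r ∈ ({m} : Finset V), r ∈ W) ∧ ∃ r ∈ ent', r ∈ W) ∧ j' ∈ W), ν W * (c W - d W)) * (∑ W ∈ U.powerset.filter (fun W => (m ∈ W ∧ ¬ (j ∈ W ∧ j' ∈ W)) ∧ j ∈ W), ν W * d W) ≤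
      (∑ W ∈ U.powerset.filter (fun W => ¬ ∃ r ∈ ({m} : Finset V), r ∈ W), ν W * (if ∃ r ∈ ent', r ∈ W then c W - d W else c W) * (1 - y W)) * (∑ W ∈ U.powerset.filter (fun W => m ∈ W ∧ j ∈ W ∧ j' ∈ W), ν W * d W) := by
  have hpw0 : ∀ W, 0 ≤ (if ∃ r ∈ ent', r ∈ W then c W - d W else c W) := fun W => by split_ifs <;> linarith [hdc W, hc0 W]
  have hy1 : ∀ W, 0 ≤ 1 - y W := fun W => by rw [hy W]; split_ifs <;> norm_num
  refine ad_sets_dec U (fun W => ν W * (c W - d W)) (fun W => ν W * d W)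
    (fun W => ν W * (if ∃ r ∈ ent', r ∈ W then c W - d W else c W) * (1 - y W)) (fun W => ν W * d W)
    (fun W => mul_nonneg (hν0 W) (by linarith [hdc W])) (fun W => mul_nonneg (hν0 W) (hd0 W))
    (fun W => mul_nonneg (mul_nonneg (hν0 W) (hpw0 W)) (hy1 W)) (fun W => mul_nonneg (hν0 W) (hd0 W))
    (fun W => ((¬ ∃ r ∈ ({m} : Finset V), r ∈ W) ∧ ∃ r ∈ ent', r ∈ W) ∧ j' ∈ W) (fun W => (m ∈ W ∧ ¬ (j ∈ W ∧ j' ∈ W)) ∧ j ∈ W) (fun W => ¬ ∃ r ∈ ({m} : Finset V), r ∈ W) (fun W => m ∈ W ∧ j ∈ W ∧ j' ∈ W) ?_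
  intro s hs t ht hA hB
  have hjt : j' ∉ t := fun h => hB.1.2 ⟨hB.2, h⟩
  have hms : m ∉ s := fun h => hA.1.1 ⟨m, Finset.mem_singleton_self m, h⟩
  refine ⟨fun ⟨r, hr, hrW⟩ => hms (Finset.mem_singleton.1 hr ▸ (Finset.mem_inter.1 hrW).1),
    ⟨Finset.mem_union.2 (Or.inr hB.1.1), Finset.mem_union.2 (Or.inr hB.2), Finset.mem_union.2 (Or.inl hA.2)⟩, ?_⟩
  have hyst : y (s ∩ t) = 0 := by rw [hy]; exact if_neg (fun h => hjt (Finset.mem_inter.1 h).2)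
  have hpiece : c (s ∩ t) - d (s ∩ t) ≤ (if ∃ r ∈ ent', r ∈ (s ∩ t) then c (s ∩ t) - d (s ∩ t) else c (s ∩ t)) := by
    split_ifs <;> linarith [hd0 (s ∩ t)]
  have hpw := closed_gate_pw c d hc0 hd0 hdc hcd hratio s t
  calc ν s * (c s - d s) * (ν t * d t) = (ν s * ν t) * ((c s - d s) * d t) := by ring
    _ ≤ (ν (s ∩ t) * ν (s ∪ t)) * ((c (s ∩ t) - d (s ∩ t)) * d (s ∪ t)) :=
        mul_le_mul (hν s hs t ht) hpw (mul_nonneg (by linarith [hdc s]) (hd0 t)) (mul_nonneg (hν0 _) (hν0 _))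
    _ ≤ (ν (s ∩ t) * ν (s ∪ t)) * ((if ∃ r ∈ ent', r ∈ (s ∩ t) then c (s ∩ t) - d (s ∩ t) else c (s ∩ t)) * d (s ∪ t)) :=
        mul_le_mul_of_nonneg_left (mul_le_mul_of_nonneg_right hpiece (hd0 _)) (mul_nonneg (hν0 _) (hν0 _))
    _ = ν (s ∩ t) * (if ∃ r ∈ ent', r ∈ (s ∩ t) then c (s ∩ t) - d (s ∩ t) else c (s ∩ t)) * (1 - y (s ∩ t)) * (ν (s ∪ t) * d (s ∪ t)) := by
        rw [hyst]; ring

end TopGateFacts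

section TopGateMain

variable {V : Type*} [DecidableEq V] {R : Type*} [Field R] [LinearOrder R] [IsStrictOrderedRing R]

set_option maxHeartbeats 1600000 in
/-- **THE THREE-COIN TOP GATE, CLOSED MODULO ITS ZERO-IDEAL-MASS VALUE**: for `ent = {m}`, any
`ent' ∋ j, j'`, the entry markers `x = 1[j ∈ ·]`, `y = 1[j' ∈ ·]` and the top gate
`d' = d·1[{m, j, j'} ⊆ W]`, the cleared (XA′) `Cross ≤ a0·U001` follows from the nonnegativity of the
parts functional at zero ideal mass (`H0`, with the killed mass `a + δ` — the open piece of §72.10). -/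
theorem chain_XA'_top_of_a0 (U : Finset V) (m j j' : V) (ent' : Finset V) (ν c d : Finset V → R)
    (hj : j ∈ ent') (hj' : j' ∈ ent')
    (hν0 : ∀ W, 0 ≤ ν W) (hν : ∀ s ⊆ U, ∀ t ⊆ U, ν s * ν t ≤ ν (s ∩ t) * ν (s ∪ t))
    (hc0 : ∀ W, 0 ≤ c W) (hd0 : ∀ W, 0 ≤ d W) (hdc : ∀ W, d W ≤ c W)
    (hcd : ∀ s t, c s * d t ≤ c (s ∩ t) * d (s ∪ t))
    (hratio : ∀ s t, s ⊆ t → d s * c t ≤ c s * d t)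
    (x y : Finset V → R) (hx : ∀ W, x W = if j ∈ W then 1 else 0) (hy : ∀ W, y W = if j' ∈ W then 1 else 0)
    (H0 : 0 ≤ (0) * (0 + (∑ W ∈ U.powerset.filter (fun W => ¬ ∃ r ∈ ({m} : Finset V) ∪ ent', r ∈ W), ν W * c W) + (∑ W ∈ U.powerset.filter (fun W => (¬ ∃ r ∈ ({m} : Finset V), r ∈ W) ∧ ∃ r ∈ ent', r ∈ W), ν W * (c W - d W)) + (∑ W ∈ U.powerset.filter (fun W => (¬ ∃ r ∈ ({m} : Finset V), r ∈ W) ∧ ∃ r ∈ ent', r ∈ W), ν W * d W) + ((∑ W ∈ U.powerset.filter (fun W => m ∈ W ∧ j ∈ W ∧ j' ∈ W), ν W * d W) + (∑ W ∈ U.powerset.filter (fun W => m ∈ W ∧ ¬ (j ∈ W ∧ j' ∈ W)), ν W * d W))) * ((∑ W ∈ U.powerset.filter (fun W => (¬ ∃ r ∈ ({m} : Finset V), r ∈ W) ∧ ∃ r ∈ ent', r ∈ W), ν W * (c W - d W) * x W) + (∑ W ∈ U.powerset.filter (fun W => (¬ ∃ r ∈ ({m} : Finset V), r ∈ W) ∧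 ∃ r ∈ ent', r ∈ W), ν W * d W * x W) + ((∑ W ∈ U.powerset.filter (fun W => m ∈ W ∧ j ∈ W ∧ j' ∈ W), ν W * d W) + (∑ W ∈ U.powerset.filter (fun W => m ∈ W ∧ ¬ (j ∈ W ∧ j' ∈ W)), ν W * d W * x W))) * ((∑ W ∈ U.powerset.filter (fun W => (¬ ∃ r ∈ ({m} : Finset V), r ∈ W) ∧ ∃ r ∈ ent', r ∈ W), ν W * (c W - d W) * y W) + (∑ W ∈ U.powerset.filter (fun W => (¬ ∃ r ∈ ({m} : Finset V), r ∈ W) ∧ ∃ r ∈ ent', r ∈ W), ν W * d W * y W) + ((∑ W ∈ U.powerset.filter (fun W => m ∈ W ∧ j ∈ W ∧ j' ∈ W), ν W * d W) + (∑ W ∈ U.powerset.filter (fun W => m ∈ W ∧ ¬ (j ∈ W ∧ j' ∈ W)), ν W * d W * y W)))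
        - ((∑ W ∈ U.powerset.filter (fun W => (¬ ∃ r ∈ ({m} : Finset V), r ∈ W) ∧ ∃ r ∈ ent', r ∈ W), ν W * (c W - d W) * x W) * (0 + (∑ W ∈ U.powerset.filter (fun W => ¬ ∃ r ∈ ({m} : Finset V) ∪ ent', r ∈ W), ν W * c W) + (∑ W ∈ U.powerset.filter (fun W => (¬ ∃ r ∈ ({m} : Finset V), r ∈ W) ∧ ∃ r ∈ ent', r ∈ W), ν W * (c W - d W)) + (∑ W ∈ U.powerset.filter (fun W => (¬ ∃ r ∈ ({m} : Finset V), r ∈ W) ∧ ∃ r ∈ ent', r ∈ W), ν W * d W) + ((∑ W ∈ U.powerset.filter (fun W => m ∈ W ∧ j ∈ W ∧ j' ∈ W), ν W * d W) + (∑ W ∈ U.powerset.filter (fun W => m ∈ W ∧ ¬ (j ∈ W ∧ j' ∈ W)), ν W * d W))) - ((∑ W ∈ U.powerset.filter (fun W => ¬ ∃ r ∈ ({m} : Finset V) ∪ ent', r ∈ W), ν W * c W) + (∑ W ∈ U.powerset.filter (fun W => (¬ ∃ r ∈ ({m} : Finset V), r ∈ W) ∧ ∃ r ∈ ent', r ∈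 W), ν W * (c W - d W))) * ((∑ W ∈ U.powerset.filter (fun W => (¬ ∃ r ∈ ({m} : Finset V), r ∈ W) ∧ ∃ r ∈ ent', r ∈ W), ν W * (c W - d W) * x W) + (∑ W ∈ U.powerset.filter (fun W => (¬ ∃ r ∈ ({m} : Finset V), r ∈ W) ∧ ∃ r ∈ ent', r ∈ W), ν W * d W * x W) + ((∑ W ∈ U.powerset.filter (fun W => m ∈ W ∧ j ∈ W ∧ j' ∈ W), ν W * d W) + (∑ W ∈ U.powerset.filter (fun W => m ∈ W ∧ ¬ (j ∈ W ∧ j' ∈ W)), ν W * d W * x W)))) * (((∑ W ∈ U.powerset.filter (fun W => m ∈ W ∧ j ∈ W ∧ j' ∈ W), ν W * d W) + (∑ W ∈ U.powerset.filter (fun W => m ∈ W ∧ ¬ (j ∈ W ∧ j' ∈ W)), ν W * d W * y W)) * (0 + (∑ W ∈ U.powerset.filter (fun W => ¬ ∃ r ∈ ({m} : Finset V) ∪ ent', r ∈ W), ν W * c W) + (∑ W ∈ U.powerset.filter (fun W => (¬ ∃ r ∈ ({m} : Finset V), r ∈ W) ∧ ∃ r ∈ ent', r ∈ W), ν W * (c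 W - d W)) + (∑ W ∈ U.powerset.filter (fun W => (¬ ∃ r ∈ ({m} : Finset V), r ∈ W) ∧ ∃ r ∈ ent', r ∈ W), ν W * d W) + ((∑ W ∈ U.powerset.filter (fun W => m ∈ W ∧ j ∈ W ∧ j' ∈ W), ν W * d W) + (∑ W ∈ U.powerset.filter (fun W => m ∈ W ∧ ¬ (j ∈ W ∧ j' ∈ W)), ν W * d W))) - ((∑ W ∈ U.powerset.filter (fun W => m ∈ W ∧ j ∈ W ∧ j' ∈ W), ν W * d W) + (∑ W ∈ U.powerset.filter (fun W => m ∈ W ∧ ¬ (j ∈ W ∧ j' ∈ W)), ν W * d W)) * ((∑ W ∈ U.powerset.filter (fun W => (¬ ∃ r ∈ ({m} : Finset V), r ∈ W) ∧ ∃ r ∈ ent', r ∈ W), ν W * (c W - d W) * y W) + (∑ W ∈ U.powerset.filter (fun W => (¬ ∃ r ∈ ({m} : Finset V), r ∈ W) ∧ ∃ r ∈ ent', r ∈ W), ν W * d W * y W) + ((∑ W ∈ U.powerset.filter (fun W => m ∈ W ∧ j ∈ W ∧ j' ∈ W), ν W * d W) + (∑ W ∈ U.powerset.filter (fun W => m ∈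 W ∧ ¬ (j ∈ W ∧ j' ∈ W)), ν W * d W * y W))))
        - ((∑ W ∈ U.powerset.filter (fun W => (¬ ∃ r ∈ ({m} : Finset V), r ∈ W) ∧ ∃ r ∈ ent', r ∈ W), ν W * (c W - d W) * y W) * (0 + (∑ W ∈ U.powerset.filter (fun W => ¬ ∃ r ∈ ({m} : Finset V) ∪ ent', r ∈ W), ν W * c W) + (∑ W ∈ U.powerset.filter (fun W => (¬ ∃ r ∈ ({m} : Finset V), r ∈ W) ∧ ∃ r ∈ ent', r ∈ W), ν W * (c W - d W)) + (∑ W ∈ U.powerset.filter (fun W => (¬ ∃ r ∈ ({m} : Finset V), r ∈ W) ∧ ∃ r ∈ ent', r ∈ W), ν W * d W) + ((∑ W ∈ U.powerset.filter (fun W => m ∈ W ∧ j ∈ W ∧ j' ∈ W), ν W * d W) + (∑ W ∈ U.powerset.filter (fun W => m ∈ W ∧ ¬ (j ∈ W ∧ j' ∈ W)), ν W * d W))) - ((∑ W ∈ U.powerset.filter (fun W => ¬ ∃ r ∈ ({m} : Finset V) ∪ ent', r ∈ W), ν W * c W) + (∑ W ∈ U.powerset.filter (fun W => (¬ ∃ r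 ∈ ({m} : Finset V), r ∈ W) ∧ ∃ r ∈ ent', r ∈ W), ν W * (c W - d W))) * ((∑ W ∈ U.powerset.filter (fun W => (¬ ∃ r ∈ ({m} : Finset V), r ∈ W) ∧ ∃ r ∈ ent', r ∈ W), ν W * (c W - d W) * y W) + (∑ W ∈ U.powerset.filter (fun W => (¬ ∃ r ∈ ({m} : Finset V), r ∈ W) ∧ ∃ r ∈ ent', r ∈ W), ν W * d W * y W) + ((∑ W ∈ U.powerset.filter (fun W => m ∈ W ∧ j ∈ W ∧ j' ∈ W), ν W * d W) + (∑ W ∈ U.powerset.filter (fun W => m ∈ W ∧ ¬ (j ∈ W ∧ j' ∈ W)), ν W * d W * y W)))) * (((∑ W ∈ U.powerset.filter (fun W => m ∈ W ∧ j ∈ W ∧ j' ∈ W), ν W * d W) + (∑ W ∈ U.powerset.filter (fun W => m ∈ W ∧ ¬ (j ∈ W ∧ j' ∈ W)), ν W * d W * x W)) * (0 + (∑ W ∈ U.powerset.filter (fun W => ¬ ∃ r ∈ ({m} : Finset V) ∪ ent', r ∈ W), ν W * c W) + (∑ W ∈ U.powerset.filter (fun W => (¬ ∃ r ∈ ({m}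 : Finset V), r ∈ W) ∧ ∃ r ∈ ent', r ∈ W), ν W * (c W - d W)) + (∑ W ∈ U.powerset.filter (fun W => (¬ ∃ r ∈ ({m} : Finset V), r ∈ W) ∧ ∃ r ∈ ent', r ∈ W), ν W * d W) + ((∑ W ∈ U.powerset.filter (fun W => m ∈ W ∧ j ∈ W ∧ j' ∈ W), ν W * d W) + (∑ W ∈ U.powerset.filter (fun W => m ∈ W ∧ ¬ (j ∈ W ∧ j' ∈ W)), ν W * d W))) - ((∑ W ∈ U.powerset.filter (fun W => m ∈ W ∧ j ∈ W ∧ j' ∈ W), ν W * d W) + (∑ W ∈ U.powerset.filter (fun W => m ∈ W ∧ ¬ (j ∈ W ∧ j' ∈ W)), ν W * d W)) * ((∑ W ∈ U.powerset.filter (fun W => (¬ ∃ r ∈ ({m} : Finset V), r ∈ W) ∧ ∃ r ∈ ent', r ∈ W), ν W * (c W - d W) * x W) + (∑ W ∈ U.powerset.filter (fun W => (¬ ∃ r ∈ ({m} : Finset V), r ∈ W) ∧ ∃ r ∈ ent', r ∈ W), ν W * d W * x W) + ((∑ W ∈ U.powerset.filter (fun W => m ∈ W ∧ j ∈ W ∧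 j' ∈ W), ν W * d W) + (∑ W ∈ U.powerset.filter (fun W => m ∈ W ∧ ¬ (j ∈ W ∧ j' ∈ W)), ν W * d W * x W))))
        + (∑ W ∈ U.powerset.filter (fun W => m ∈ W ∧ j ∈ W ∧ j' ∈ W), ν W * d W) * ((0 + (∑ W ∈ U.powerset.filter (fun W => ¬ ∃ r ∈ ({m} : Finset V) ∪ ent', r ∈ W), ν W * c W) + (∑ W ∈ U.powerset.filter (fun W => (¬ ∃ r ∈ ({m} : Finset V), r ∈ W) ∧ ∃ r ∈ ent', r ∈ W), ν W * (c W - d W)) + (∑ W ∈ U.powerset.filter (fun W => (¬ ∃ r ∈ ({m} : Finset V), r ∈ W) ∧ ∃ r ∈ ent', r ∈ W), ν W * d W) + ((∑ W ∈ U.powerset.filter (fun W => m ∈ W ∧ j ∈ W ∧ j' ∈ W), ν W * d W) + (∑ W ∈ U.powerset.filter (fun W => m ∈ W ∧ ¬ (j ∈ W ∧ j' ∈ W)), ν W * d W))) * ((0 + (∑ W ∈ U.powerset.filter (fun W => ¬ ∃ r ∈ ({m} : Finset V) ∪ ent', r ∈ W), ν W * c W) + (∑ W ∈ U.powerset.filter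 (fun W => (¬ ∃ r ∈ ({m} : Finset V), r ∈ W) ∧ ∃ r ∈ ent', r ∈ W), ν W * (c W - d W)) + (∑ W ∈ U.powerset.filter (fun W => (¬ ∃ r ∈ ({m} : Finset V), r ∈ W) ∧ ∃ r ∈ ent', r ∈ W), ν W * d W) + ((∑ W ∈ U.powerset.filter (fun W => m ∈ W ∧ j ∈ W ∧ j' ∈ W), ν W * d W) + (∑ W ∈ U.powerset.filter (fun W => m ∈ W ∧ ¬ (j ∈ W ∧ j' ∈ W)), ν W * d W))) - ((∑ W ∈ U.powerset.filter (fun W => (¬ ∃ r ∈ ({m} : Finset V), r ∈ W) ∧ ∃ r ∈ ent', r ∈ W), ν W * (c W - d W) * x W) + (∑ W ∈ U.powerset.filter (fun W => (¬ ∃ r ∈ ({m} : Finset V), r ∈ W) ∧ ∃ r ∈ ent', r ∈ W), ν W * d W * x W) + ((∑ W ∈ U.powerset.filter (fun W => m ∈ W ∧ j ∈ W ∧ j' ∈ W), ν W * d W) + (∑ W ∈ U.powerset.filter (fun W => m ∈ W ∧ ¬ (j ∈ W ∧ j' ∈ W)), ν W * d W * x W)))) * ((0 + (∑ W ∈ U.powerset.filter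 (fun W => ¬ ∃ r ∈ ({m} : Finset V) ∪ ent', r ∈ W), ν W * c W) + (∑ W ∈ U.powerset.filter (fun W => (¬ ∃ r ∈ ({m} : Finset V), r ∈ W) ∧ ∃ r ∈ ent', r ∈ W), ν W * (c W - d W)) + (∑ W ∈ U.powerset.filter (fun W => (¬ ∃ r ∈ ({m} : Finset V), r ∈ W) ∧ ∃ r ∈ ent', r ∈ W), ν W * d W) + ((∑ W ∈ U.powerset.filter (fun W => m ∈ W ∧ j ∈ W ∧ j' ∈ W), ν W * d W) + (∑ W ∈ U.powerset.filter (fun W => m ∈ W ∧ ¬ (j ∈ W ∧ j' ∈ W)), ν W * d W))) - ((∑ W ∈ U.powerset.filter (fun W => (¬ ∃ r ∈ ({m} : Finset V), r ∈ W) ∧ ∃ r ∈ ent', r ∈ W), ν W * (c W - d W) * y W) + (∑ W ∈ U.powerset.filter (fun W => (¬ ∃ r ∈ ({m} : Finset V), r ∈ W) ∧ ∃ r ∈ ent', r ∈ W), ν W * d W * y W) + ((∑ W ∈ U.powerset.filter (fun W => m ∈ W ∧ j ∈ W ∧ j' ∈ W), ν W * d W) + (∑ W ∈ U.powerset.filter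 (fun W => m ∈ W ∧ ¬ (j ∈ W ∧ j' ∈ W)), ν W * d W * y W))))
            + ((∑ W ∈ U.powerset.filter (fun W => (¬ ∃ r ∈ ({m} : Finset V), r ∈ W) ∧ ∃ r ∈ ent', r ∈ W), ν W * (c W - d W) * x W) * (0 + (∑ W ∈ U.powerset.filter (fun W => ¬ ∃ r ∈ ({m} : Finset V) ∪ ent', r ∈ W), ν W * c W) + (∑ W ∈ U.powerset.filter (fun W => (¬ ∃ r ∈ ({m} : Finset V), r ∈ W) ∧ ∃ r ∈ ent', r ∈ W), ν W * (c W - d W)) + (∑ W ∈ U.powerset.filter (fun W => (¬ ∃ r ∈ ({m} : Finset V), r ∈ W) ∧ ∃ r ∈ ent', r ∈ W), ν W * d W) + ((∑ W ∈ U.powerset.filter (fun W => m ∈ W ∧ j ∈ W ∧ j' ∈ W), ν W * d W) + (∑ W ∈ U.powerset.filter (fun W => m ∈ W ∧ ¬ (j ∈ W ∧ j' ∈ W)), ν W * d W))) - ((∑ W ∈ U.powerset.filter (fun W => ¬ ∃ r ∈ ({m} : Finset V) ∪ ent', r ∈ W), ν W * c W) + (∑ W ∈ U.powerset.filter (fun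 W => (¬ ∃ r ∈ ({m} : Finset V), r ∈ W) ∧ ∃ r ∈ ent', r ∈ W), ν W * (c W - d W))) * ((∑ W ∈ U.powerset.filter (fun W => (¬ ∃ r ∈ ({m} : Finset V), r ∈ W) ∧ ∃ r ∈ ent', r ∈ W), ν W * (c W - d W) * x W) + (∑ W ∈ U.powerset.filter (fun W => (¬ ∃ r ∈ ({m} : Finset V), r ∈ W) ∧ ∃ r ∈ ent', r ∈ W), ν W * d W * x W) + ((∑ W ∈ U.powerset.filter (fun W => m ∈ W ∧ j ∈ W ∧ j' ∈ W), ν W * d W) + (∑ W ∈ U.powerset.filter (fun W => m ∈ W ∧ ¬ (j ∈ W ∧ j' ∈ W)), ν W * d W * x W)))) * ((0 + (∑ W ∈ U.powerset.filter (fun W => ¬ ∃ r ∈ ({m} : Finset V) ∪ ent', r ∈ W), ν W * c W) + (∑ W ∈ U.powerset.filter (fun W => (¬ ∃ r ∈ ({m} : Finset V), r ∈ W) ∧ ∃ r ∈ ent', r ∈ W), ν W * (c W - d W)) + (∑ W ∈ U.powerset.filter (fun W => (¬ ∃ r ∈ ({m} : Finset V), r ∈ W) ∧ ∃ r ∈ ent',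 r ∈ W), ν W * d W) + ((∑ W ∈ U.powerset.filter (fun W => m ∈ W ∧ j ∈ W ∧ j' ∈ W), ν W * d W) + (∑ W ∈ U.powerset.filter (fun W => m ∈ W ∧ ¬ (j ∈ W ∧ j' ∈ W)), ν W * d W))) - ((∑ W ∈ U.powerset.filter (fun W => (¬ ∃ r ∈ ({m} : Finset V), r ∈ W) ∧ ∃ r ∈ ent', r ∈ W), ν W * (c W - d W) * y W) + (∑ W ∈ U.powerset.filter (fun W => (¬ ∃ r ∈ ({m} : Finset V), r ∈ W) ∧ ∃ r ∈ ent', r ∈ W), ν W * d W * y W) + ((∑ W ∈ U.powerset.filter (fun W => m ∈ W ∧ j ∈ W ∧ j' ∈ W), ν W * d W) + (∑ W ∈ U.powerset.filter (fun W => m ∈ W ∧ ¬ (j ∈ W ∧ j' ∈ W)), ν W * d W * y W))))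
            + ((∑ W ∈ U.powerset.filter (fun W => (¬ ∃ r ∈ ({m} : Finset V), r ∈ W) ∧ ∃ r ∈ ent', r ∈ W), ν W * (c W - d W) * y W) * (0 + (∑ W ∈ U.powerset.filter (fun W => ¬ ∃ r ∈ ({m} : Finset V) ∪ ent', r ∈ W), ν W * c W) + (∑ W ∈ U.powerset.filter (fun W => (¬ ∃ r ∈ ({m} : Finset V), r ∈ W) ∧ ∃ r ∈ ent', r ∈ W), ν W * (c W - d W)) + (∑ W ∈ U.powerset.filter (fun W => (¬ ∃ r ∈ ({m} : Finset V), r ∈ W) ∧ ∃ r ∈ ent', r ∈ W), ν W * d W) + ((∑ W ∈ U.powerset.filter (fun W => m ∈ W ∧ j ∈ W ∧ j' ∈ W), ν W * d W) + (∑ W ∈ U.powerset.filter (fun W => m ∈ W ∧ ¬ (j ∈ W ∧ j' ∈ W)), ν W * d W))) - ((∑ W ∈ U.powerset.filter (fun W => ¬ ∃ r ∈ ({m} : Finset V) ∪ ent', r ∈ W), ν W * c W) + (∑ W ∈ U.powerset.filter (fun W => (¬ ∃ r ∈ ({m} : Finset V), r ∈ W) ∧ ∃ r ∈ ent', r ∈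 W), ν W * (c W - d W))) * ((∑ W ∈ U.powerset.filter (fun W => (¬ ∃ r ∈ ({m} : Finset V), r ∈ W) ∧ ∃ r ∈ ent', r ∈ W), ν W * (c W - d W) * y W) + (∑ W ∈ U.powerset.filter (fun W => (¬ ∃ r ∈ ({m} : Finset V), r ∈ W) ∧ ∃ r ∈ ent', r ∈ W), ν W * d W * y W) + ((∑ W ∈ U.powerset.filter (fun W => m ∈ W ∧ j ∈ W ∧ j' ∈ W), ν W * d W) + (∑ W ∈ U.powerset.filter (fun W => m ∈ W ∧ ¬ (j ∈ W ∧ j' ∈ W)), ν W * d W * y W)))) * ((0 + (∑ W ∈ U.powerset.filter (fun W => ¬ ∃ r ∈ ({m} : Finset V) ∪ ent', r ∈ W), ν W * c W) + (∑ W ∈ U.powerset.filter (fun W => (¬ ∃ r ∈ ({m} : Finset V), r ∈ W) ∧ ∃ r ∈ ent', r ∈ W), ν W * (c W - d W)) + (∑ W ∈ U.powerset.filter (fun W => (¬ ∃ r ∈ ({m} : Finset V), r ∈ W) ∧ ∃ r ∈ ent', r ∈ W), ν W * d W) + ((∑ W ∈ U.powerset.filter (fun W => m ∈ W ∧ j ∈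 W ∧ j' ∈ W), ν W * d W) + (∑ W ∈ U.powerset.filter (fun W => m ∈ W ∧ ¬ (j ∈ W ∧ j' ∈ W)), ν W * d W))) - ((∑ W ∈ U.powerset.filter (fun W => (¬ ∃ r ∈ ({m} : Finset V), r ∈ W) ∧ ∃ r ∈ ent', r ∈ W), ν W * (c W - d W) * x W) + (∑ W ∈ U.powerset.filter (fun W => (¬ ∃ r ∈ ({m} : Finset V), r ∈ W) ∧ ∃ r ∈ ent', r ∈ W), ν W * d W * x W) + ((∑ W ∈ U.powerset.filter (fun W => m ∈ W ∧ j ∈ W ∧ j' ∈ W), ν W * d W) + (∑ W ∈ U.powerset.filter (fun W => m ∈ W ∧ ¬ (j ∈ W ∧ j' ∈ W)), ν W * d W * x W)))))) :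
    (((∑ W ∈ U.powerset, ν W * chainMix {m} ent' 0 c d W) * (∑ W ∈ U.powerset, ν W * chainMix {m} ent' 1 c d W * x W) - (∑ W ∈ U.powerset, ν W * chainMix {m} ent' 0 c d W * x W) * (∑ W ∈ U.powerset, ν W * chainMix {m} ent' 1 c d W)) *
          ((∑ W ∈ U.powerset, ν W * chainMix {m} ent' 0 c d W) * (∑ W ∈ U.powerset, ν W * chainMix {m} ent' 0 c (fun W => if m ∈ W ∧ j ∈ W ∧ j' ∈ W then d W else 0) W * y W) - (∑ W ∈ U.powerset, ν W * chainMix {m} ent' 0 c d W * y W) * (∑ W ∈ U.powerset, ν W * chainMix {m} ent' 0 c (fun W => if m ∈ W ∧ j ∈ W ∧ j' ∈ W then d W else 0) W))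
        + ((∑ W ∈ U.powerset, ν W * chainMix {m} ent' 0 c d W) * (∑ W ∈ U.powerset, ν W * chainMix {m} ent' 1 c d W * y W) - (∑ W ∈ U.powerset, ν W * chainMix {m} ent' 0 c d W * y W) * (∑ W ∈ U.powerset, ν W * chainMix {m} ent' 1 c d W)) *
          ((∑ W ∈ U.powerset, ν W * chainMix {m} ent' 0 c d W) * (∑ W ∈ U.powerset, ν W * chainMix {m} ent' 0 c (fun W => if m ∈ W ∧ j ∈ W ∧ j' ∈ W then d W else 0) W * x W) - (∑ W ∈ U.powerset, ν W * chainMix {m} ent' 0 c d W * x W) * (∑ W ∈ U.powerset, ν W * chainMix {m} ent' 0 c (fun W => if m ∈ W ∧ j ∈ W ∧ j' ∈ W then d W else 0) W))) ≤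
        (∑ W ∈ U.powerset, ν W * chainMix {m} ent' 0 c d W) * ((∑ W ∈ U.powerset, ν W * chainMix {m} ent' 0 c d W) * (∑ W ∈ U.powerset, ν W * chainMix {m} ent' 0 c d W) * (∑ W ∈ U.powerset, ν W * chainMix {m} ent' 1 c (fun W => if m ∈ W ∧ j ∈ W ∧ j' ∈ W then d W else 0) W * (x W * y W))
          - (∑ W ∈ U.powerset, ν W * chainMix {m} ent' 0 c d W) * (∑ W ∈ U.powerset, ν W * chainMix {m} ent' 0 c d W * y W) * (∑ W ∈ U.powerset, ν W * chainMix {m} ent' 1 c (fun W => if m ∈ W ∧ j ∈ W ∧ j' ∈ W then d W else 0) W * x W)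
          - (∑ W ∈ U.powerset, ν W * chainMix {m} ent' 0 c d W) * (∑ W ∈ U.powerset, ν W * chainMix {m} ent' 0 c d W * x W) * (∑ W ∈ U.powerset, ν W * chainMix {m} ent' 1 c (fun W => if m ∈ W ∧ j ∈ W ∧ j' ∈ W then d W else 0) W * y W)
          + (∑ W ∈ U.powerset, ν W * chainMix {m} ent' 0 c d W * x W) * (∑ W ∈ U.powerset, ν W * chainMix {m} ent' 0 c d W * y W) * (∑ W ∈ U.powerset, ν W * chainMix {m} ent' 1 c (fun W => if m ∈ W ∧ j ∈ W ∧ j' ∈ W then d W else 0) W)) := by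
  -- the markers
  have hx0 : ∀ W, 0 ≤ x W := fun W => by rw [hx W]; split_ifs <;> norm_num
  have hy0 : ∀ W, 0 ≤ y W := fun W => by rw [hy W]; split_ifs <;> norm_num
  have hx1 : ∀ W, x W ≤ 1 := fun W => by rw [hx W]; split_ifs <;> norm_num
  have hy1 : ∀ W, y W ≤ 1 := fun W => by rw [hy W]; split_ifs <;> norm_num
  have hxm : ∀ s t, x s ≤ x (s ∪ t) := fun s t => by
    rw [hx s, hx (s ∪ t)]
    by_cases h : j ∈ s
    · rw [if_pos h, if_pos (Finset.mem_union_left t h)]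
    · rw [if_neg h]; split_ifs <;> norm_num
  have hym : ∀ s t, y s ≤ y (s ∪ t) := fun s t => by
    rw [hy s, hy (s ∪ t)]
    by_cases h : j' ∈ s
    · rw [if_pos h, if_pos (Finset.mem_union_left t h)]
    · rw [if_neg h]; split_ifs <;> norm_num
  have hxI : ∀ W, (¬ ∃ r ∈ ({m} : Finset V) ∪ ent', r ∈ W) → x W = 0 := fun W hW => by
    rw [hx W]; exact if_neg (fun h => hW ⟨j, Finset.mem_union.2 (Or.inr hj), h⟩)
  have hyI : ∀ W, (¬ ∃ r ∈ ({m} : Finset V) ∪ ent', r ∈ W) → y W = 0 := fun W hW => by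
    rw [hy W]; exact if_neg (fun h => hW ⟨j', Finset.mem_union.2 (Or.inr hj'), h⟩)
  have hxT : ∀ W, (m ∈ W ∧ j ∈ W ∧ j' ∈ W) → x W = 1 := fun W hW => by rw [hx W]; exact if_pos hW.2.1
  have hyT : ∀ W, (m ∈ W ∧ j ∈ W ∧ j' ∈ W) → y W = 1 := fun W hW => by rw [hy W]; exact if_pos hW.2.2
  have hxyT : ∀ W, (m ∈ W ∧ j ∈ W ∧ j' ∈ W) → x W * y W = 1 := fun W hW => by
    rw [hxT W hW, hyT W hW, mul_one]
  -- the thirteen moments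
  have hxy := cg_top_g U m j j' ent' ν c d (fun W => x W * y W)
  rw [cg_a0 U {m} ent' ν c d, cg_mom0 U {m} ent' ν c d x, cg_mom0 U {m} ent' ν c d y,
    cg_b0 U {m} ent' ν c d, cg_mom1 U {m} ent' ν c d x, cg_mom1 U {m} ent' ν c d y,
    cg_top_e0 U m j j' ent' ν c d, cg_top_e U m j j' ent' ν c d x, cg_top_e U m j j' ent' ν c d y,
    cg_top_g0 U m j j' ent' ν c d, cg_top_g U m j j' ent' ν c d x, cg_top_g U m j j' ent' ν c d y, hxy,
    sum_M_split_top U m j j' (fun W => ν W * d W), sum_M_split_top U m j j' (fun W => ν W * d W * x W),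
    sum_M_split_top U m j j' (fun W => ν W * d W * y W)]
  have hIx : (∑ W ∈ U.powerset.filter (fun W => ¬ ∃ r ∈ ({m} : Finset V) ∪ ent', r ∈ W), ν W * c W * x W) = 0 := cgate_sum_zero U _ _ (fun W hW => by rw [hxI W hW, mul_zero])
  have hIy : (∑ W ∈ U.powerset.filter (fun W => ¬ ∃ r ∈ ({m} : Finset V) ∪ ent', r ∈ W), ν W * c W * y W) = 0 := cgate_sum_zero U _ _ (fun W hW => by rw [hyI W hW, mul_zero])
  have hIxy : (∑ W ∈ U.powerset.filter (fun W => ¬ ∃ r ∈ ({m} : Finset V) ∪ ent', r ∈ W), ν W * c W * (x W * y W)) = 0 :=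
    cgate_sum_zero U _ _ (fun W hW => by rw [hxI W hW, zero_mul, mul_zero])
  rw [hIx, hIy, hIxy, cg_sum_weight_one U _ (fun W => ν W * d W) x hxT, cg_sum_weight_one U _ (fun W => ν W * d W) y hyT,
    cg_sum_weight_one U _ (fun W => ν W * d W) (fun W => x W * y W) hxyT,
    cg_split' U ν c d (fun W => (¬ ∃ r ∈ ({m} : Finset V), r ∈ W) ∧ ∃ r ∈ ent', r ∈ W), cg_split U ν c d (fun W => (¬ ∃ r ∈ ({m} : Finset V), r ∈ W) ∧ ∃ r ∈ ent', r ∈ W) x, cg_split U ν c d (fun W => (¬ ∃ r ∈ ({m} : Finset V), r ∈ W) ∧ ∃ r ∈ ent', r ∈ W) y]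
  -- the part sums
  set a := (∑ W ∈ U.powerset.filter (fun W => ¬ ∃ r ∈ ({m} : Finset V) ∪ ent', r ∈ W), ν W * c W) with ha_def
  set δ := (∑ W ∈ U.powerset.filter (fun W => (¬ ∃ r ∈ ({m} : Finset V), r ∈ W) ∧ ∃ r ∈ ent', r ∈ W), ν W * (c W - d W)) with hδ_def
  set u := (∑ W ∈ U.powerset.filter (fun W => (¬ ∃ r ∈ ({m} : Finset V), r ∈ W) ∧ ∃ r ∈ ent', r ∈ W), ν W * d W) with hu_def
  set ω := (∑ W ∈ U.powerset.filter (fun W => m ∈ W ∧ j ∈ W ∧ j' ∈ W), ν W * d W) with hω_def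
  set tR := (∑ W ∈ U.powerset.filter (fun W => m ∈ W ∧ ¬ (j ∈ W ∧ j' ∈ W)), ν W * d W) with htR_def
  set XJ := (∑ W ∈ U.powerset.filter (fun W => (¬ ∃ r ∈ ({m} : Finset V), r ∈ W) ∧ ∃ r ∈ ent', r ∈ W), ν W * (c W - d W) * x W) with hXJ_def
  set XU := (∑ W ∈ U.powerset.filter (fun W => (¬ ∃ r ∈ ({m} : Finset V), r ∈ W) ∧ ∃ r ∈ ent', r ∈ W), ν W * d W * x W) with hXU_def
  set XR := (∑ W ∈ U.powerset.filter (fun W => m ∈ W ∧ ¬ (j ∈ W ∧ j' ∈ W)), ν W * d W * x W) with hXR_def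
  set YJ := (∑ W ∈ U.powerset.filter (fun W => (¬ ∃ r ∈ ({m} : Finset V), r ∈ W) ∧ ∃ r ∈ ent', r ∈ W), ν W * (c W - d W) * y W) with hYJ_def
  set YU := (∑ W ∈ U.powerset.filter (fun W => (¬ ∃ r ∈ ({m} : Finset V), r ∈ W) ∧ ∃ r ∈ ent', r ∈ W), ν W * d W * y W) with hYU_def
  set YR := (∑ W ∈ U.powerset.filter (fun W => m ∈ W ∧ ¬ (j ∈ W ∧ j' ∈ W)), ν W * d W * y W) with hYR_def
  have hcd0 : ∀ W, 0 ≤ c W - d W := fun W => by linarith [hdc W]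
  have ha : 0 ≤ a := Finset.sum_nonneg (fun W _ => mul_nonneg (hν0 W) (hc0 W))
  have hδ : 0 ≤ δ := Finset.sum_nonneg (fun W _ => mul_nonneg (hν0 W) (hcd0 W))
  have hu : 0 ≤ u := Finset.sum_nonneg (fun W _ => mul_nonneg (hν0 W) (hd0 W))
  have hω : 0 ≤ ω := Finset.sum_nonneg (fun W _ => mul_nonneg (hν0 W) (hd0 W))
  have htR : 0 ≤ tR := Finset.sum_nonneg (fun W _ => mul_nonneg (hν0 W) (hd0 W))
  have hXJ : 0 ≤ XJ := Finset.sum_nonneg (fun W _ => mul_nonneg (mul_nonneg (hν0 W) (hcd0 W)) (hx0 W))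
  have hXU : 0 ≤ XU := Finset.sum_nonneg (fun W _ => mul_nonneg (mul_nonneg (hν0 W) (hd0 W)) (hx0 W))
  have hXR : 0 ≤ XR := Finset.sum_nonneg (fun W _ => mul_nonneg (mul_nonneg (hν0 W) (hd0 W)) (hx0 W))
  have hYJ : 0 ≤ YJ := Finset.sum_nonneg (fun W _ => mul_nonneg (mul_nonneg (hν0 W) (hcd0 W)) (hy0 W))
  have hYU : 0 ≤ YU := Finset.sum_nonneg (fun W _ => mul_nonneg (mul_nonneg (hν0 W) (hd0 W)) (hy0 W))
  have hYR : 0 ≤ YR := Finset.sum_nonneg (fun W _ => mul_nonneg (mul_nonneg (hν0 W) (hd0 W)) (hy0 W))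
  have hXJδ : XJ ≤ δ := Finset.sum_le_sum (fun W _ => mul_le_of_le_one_right (mul_nonneg (hν0 W) (hcd0 W)) (hx1 W))
  have hXUu : XU ≤ u := Finset.sum_le_sum (fun W _ => mul_le_of_le_one_right (mul_nonneg (hν0 W) (hd0 W)) (hx1 W))
  have hXRt : XR ≤ tR := Finset.sum_le_sum (fun W _ => mul_le_of_le_one_right (mul_nonneg (hν0 W) (hd0 W)) (hx1 W))
  have hYJδ : YJ ≤ δ := Finset.sum_le_sum (fun W _ => mul_le_of_le_one_right (mul_nonneg (hν0 W) (hcd0 W)) (hy1 W))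
  have hYUu : YU ≤ u := Finset.sum_le_sum (fun W _ => mul_le_of_le_one_right (mul_nonneg (hν0 W) (hd0 W)) (hy1 W))
  have hYRt : YR ≤ tR := Finset.sum_le_sum (fun W _ => mul_le_of_le_one_right (mul_nonneg (hν0 W) (hd0 W)) (hy1 W))
  -- the Holley facts
  have FJUx := cg_fact_JU' U {m} ent' ν c d hν0 hν hc0 hd0 hdc hcd hratio x hx0 hxm
  have FJMx := cg_fact_JM' U {m} ent' ν c d hν0 hν hc0 hd0 hdc hcd hratio x hx0 hxm
  have FJUy := cg_fact_JU' U {m} ent' ν c d hν0 hν hc0 hd0 hdc hcd hratio y hy0 hym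
  have FMx := cg_fact_McM U {m} ent' ν c d hν0 hν hc0 hd0 hcd x hx0 hxm
  rw [cg_entfree_piecewise U {m} ent' ν c d x, cg_entfree_piecewise' U {m} ent' ν c d, hIx, zero_add] at FJUx FJMx
  rw [cg_entfree_piecewise U {m} ent' ν c d y, cg_entfree_piecewise' U {m} ent' ν c d, hIy, zero_add] at FJUy
  rw [sum_M_split_top U m j j' (fun W => ν W * d W), sum_M_split_top U m j j' (fun W => ν W * d W * x W),
    cg_sum_weight_one U _ (fun W => ν W * d W) x hxT] at FJMx
  rw [sum_entfree_split U {m} ent' (fun W => ν W * c W), cg_split' U ν c d (fun W => (¬ ∃ r ∈ ({m} : Finset V), r ∈ W) ∧ ∃ r ∈ ent', r ∈ W), cg_split U ν c d (fun W => (¬ ∃ r ∈ ({m} : Finset V), r ∈ W) ∧ ∃ r ∈ ent', r ∈ W) x,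
    sum_M_split_top U m j j' (fun W => ν W * d W), sum_M_split_top U m j j' (fun W => ν W * d W * x W),
    cg_sum_weight_one U _ (fun W => ν W * d W) x hxT] at FMx
  -- the killed-vs-gate facts
  have FIMx := cg_fact_IMk U m j j' ent' ν c d hν0 hν hc0 hd0 hdc hcd hratio x hx
  have FIMy := cg_fact_IMk' U m j j' ent' ν c d hν0 hν hc0 hd0 hdc hcd hratio y hy
  have eXJ : XJ = (∑ W ∈ U.powerset.filter (fun W => ((¬ ∃ r ∈ ({m} : Finset V), r ∈ W) ∧ ∃ r ∈ ent', r ∈ W) ∧ j ∈ W), ν W * (c W - d W)) := cg_sum_marker U _ (fun W => ν W * (c W - d W)) x j hx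
  have eYJ : YJ = (∑ W ∈ U.powerset.filter (fun W => ((¬ ∃ r ∈ ({m} : Finset V), r ∈ W) ∧ ∃ r ∈ ent', r ∈ W) ∧ j' ∈ W), ν W * (c W - d W)) := cg_sum_marker U _ (fun W => ν W * (c W - d W)) y j' hy
  have eYR : YR = (∑ W ∈ U.powerset.filter (fun W => (m ∈ W ∧ ¬ (j ∈ W ∧ j' ∈ W)) ∧ j' ∈ W), ν W * d W) := cg_sum_marker U _ (fun W => ν W * d W) y j' hy
  have eXR : XR = (∑ W ∈ U.powerset.filter (fun W => (m ∈ W ∧ ¬ (j ∈ W ∧ j' ∈ W)) ∧ j ∈ W), ν W * d W) := cg_sum_marker U _ (fun W => ν W * d W) x j hx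
  have ePx : (∑ W ∈ U.powerset.filter (fun W => ¬ ∃ r ∈ ({m} : Finset V), r ∈ W), ν W * (if ∃ r ∈ ent', r ∈ W then c W - d W else c W) * (1 - x W)) = a + δ - XJ := by
    have h1 : (∑ W ∈ U.powerset.filter (fun W => ¬ ∃ r ∈ ({m} : Finset V), r ∈ W), ν W * (if ∃ r ∈ ent', r ∈ W then c W - d W else c W) * (1 - x W)) =
        (∑ W ∈ U.powerset.filter (fun W => ¬ ∃ r ∈ ({m} : Finset V), r ∈ W), ν W * (if ∃ r ∈ ent', r ∈ W then c W - d W else c W)) - (∑ W ∈ U.powerset.filter (fun W => ¬ ∃ r ∈ ({m} : Finset V), r ∈ W), ν W * (if ∃ r ∈ ent', r ∈ W then c W - d W else c W) * x W) := by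
      rw [← Finset.sum_sub_distrib]; exact Finset.sum_congr rfl (fun W _ => by ring)
    rw [h1, cg_entfree_piecewise U {m} ent' ν c d x, cg_entfree_piecewise' U {m} ent' ν c d, hIx]; ring
  have ePy : (∑ W ∈ U.powerset.filter (fun W => ¬ ∃ r ∈ ({m} : Finset V), r ∈ W), ν W * (if ∃ r ∈ ent', r ∈ W then c W - d W else c W) * (1 - y W)) = a + δ - YJ := by
    have h1 : (∑ W ∈ U.powerset.filter (fun W => ¬ ∃ r ∈ ({m} : Finset V), r ∈ W), ν W * (if ∃ r ∈ ent', r ∈ W then c W - d W else c W) * (1 - y W)) =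
        (∑ W ∈ U.powerset.filter (fun W => ¬ ∃ r ∈ ({m} : Finset V), r ∈ W), ν W * (if ∃ r ∈ ent', r ∈ W then c W - d W else c W)) - (∑ W ∈ U.powerset.filter (fun W => ¬ ∃ r ∈ ({m} : Finset V), r ∈ W), ν W * (if ∃ r ∈ ent', r ∈ W then c W - d W else c W) * y W) := by
      rw [← Finset.sum_sub_distrib]; exact Finset.sum_congr rfl (fun W _ => by ring)
    rw [h1, cg_entfree_piecewise U {m} ent' ν c d y, cg_entfree_piecewise' U {m} ent' ν c d, hIy]; ring
  rw [← eXJ, ← eYR, ePx] at FIMx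
  rw [← eYJ, ← eXR, ePy] at FIMy
  -- the parts inequality at the top gate
  have key := cg_top_of_a0 a δ u (ω + tR) XJ XU (ω + XR) YJ YU (ω + YR) ω ha hu (by linarith) hXJ hXU (by linarith)
    hYJ hYU (by linarith) hω (by linear_combination FJUx) (by linear_combination FJMx) (by linear_combination FMx)
    (by linear_combination FJUy) (by linear_combination FIMx) (by linear_combination FIMy)
    (by linarith) (by linarith) (by linarith) (by linarith) (by linarith) (by linarith) (by linarith) (by linarith)
    (by linear_combination H0)
  linear_combination key

end TopGateMain

end Summit.Ventures.PercRepro2.Coin
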